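import Summits.FinalStateConjecture.FinalStateConjecture.Theses.TangentConeAtIPlus
import HarnessLib

/-!
# Birth skeleton (BC3) — crux stmt-FinalStateConjecture-17670 `Theses.TangentConeAtIPlus.ConeCompletesScri` (K3, rank 4)
# line `birth` (skeleton registrar planner-skel-stmt-FinalStateConjecture-17670-0, 2026-08-17; run/shared/lean/lens3/_common/BC.md §BC3)

THE CRUX (by name, rev 4 of the route file): for EVERY admissible datum `D`, every MGHD `𝒟` and every cone
data `(N, mo, σ, dr, T, U, Φ)` (the `let Cone := …` predicate shared by the route's items: orthochronous
straight world-lines with continuous sublinear drifts and near-zone radii, disjoint drifted tubes, one late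
flat chart `Φ : U → M` into `J⁺(ιΣ)`, future-oriented, scale-invariantly `C²`-flat in the timelike interior
off the rays and unweighted-`C²`-flat on its full slabs, plus the basin clause), `𝒟` has complete future null
infinity in Christodoulou's intrinsic SOJOURN form `Summit.FinalStateConjecture.HasCompleteNullInfinity`:
`∃ B₀ ⋐ Σ, ∀ s > 0, ∃ B₁ ⋐ Σ`, every normalised future null ray `γ` from a data point `p ∉ B₁` is future
complete or spends affine time `≥ s` in `J⁺(ι B₀)`.

THE CUT — three stubs; every ray is normalised AT THE DATA exactly as in the crux (deliberately NOT against the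
cone chart's frame `Φ_*∂₀`: the typed cone data leave that frame free to carry arbitrarily boosted far-field
patches on late slabs — rate-free `C²` smallness allows radial chart slack `o(1)·|x̲|` — which would falsify any
`Φ_*∂₀`-normalised intermediate sojourn statement already on exact Schwarzschild; the three conclusions below
are about `Σ`-normalised rays and causal / scale-invariant chart-position SETS, insensitive to that freedom).
Two chart-side notions recur, both scale-invariant:
  ESCAPES(γ)  := `∀ δ > 0, ∀ τ', ∃ t₀ ∈ dom, ∀ t ∈ dom, t ≥ t₀ → γ t = Φ x` with `x⁰ ≥ τ'`, `|x̲| ≥ (1 − δ) x⁰`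
                 (chart time → +∞ along the ray and `|x̲|/x⁰ → 1`: the ray runs out along the cone);
  CERT(B₀)    := `∀ δ > 0, ∃ τ₃, Φ({x ∈ U : x⁰ ≥ τ₃, |x̲| ≤ (1 − δ) x⁰}) ⊆ J⁺(ι B₀)`
                 (the late timelike interior of the cone lies in the causal future of the core `B₀ ⋐ Σ`; it
                 fails exactly for cores inside a black-hole region of `Σ`, whose causal future can capture an
                 infalling far ray only just before it dies — e.g. next to a Kerr-like Cauchy horizon —, which is
                 why the longevity stub L is stated for CERTIFIED cores only).

* `stub_farRayTrichotomy` (T, kinematic / causal; M–L): there are a compact CERTIFIED core `B₀ ⋐ Σ` and a compact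
  `B₁ ⋐ Σ` such that every normalised null ray from `p ∉ B₁` is (i) future complete, or (ii) CAPTURED — it
  enters `J⁺(ι B₀)` at some parameter `t ≥ 0` —, or (iii) ESCAPES.  Content: a big ball `B₀` is certified
  (its future engulfs the late interior: flat front kinematics plus `J⁻(Φ x) ∩ ι(B₀) ≠ ∅`); far rays cross the
  uncharted early strip between `ι(Σ)` and the late `C²`-flat leaves of `Φ` (Cauchy stability of the far end —
  the item's own why-might-fail) and thereafter chart time increases along them; a null ray in the flat region
  has `|x̲|/x⁰ → 1` unless it enters the interior (then CERT captures it).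
* `stub_escapingRaysComplete` (E, analytic — OUTGOING COMPLETENESS; L): every normalised null ray from `Σ`
  that ESCAPES is future complete.  Content: no unbounded energy gain along outgoing rays in the wave zone,
  `∫ Γ dx⁰ < ∞` along the ray — NOT supplied by the cone data's rate-free unweighted `C²` smallness
  (`exp(∫ o(1) dx⁰)` may diverge); to be extracted from `Ric(g) = 0` and the admissible fall-off (Bondi-gauge
  `β`-integrability / weak peeling: Christodoulou–Klainerman 1993, Klainerman–Nicolò 2003, Bieri 2010,
  Shen 2024), below the regularity of the printed exterior-stability theorems.
* `stub_capturedRaysLinger` (L, analytic — INGOING LONGEVITY; L): for every compact CERTIFIED core `B₀` and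
  every `s > 0` there is a compact `B₁ ⋐ Σ` such that every normalised null ray from `p ∉ B₁` captured by
  `J⁺(ι B₀)` is future complete, or sojourns `≥ s` in `J⁺(ι B₀)`, or ESCAPES.  Content: a far captured
  non-escaping ray enters the late interior at chart radius `≈ |p|/2`, at distance `≳ (1 − v)|p|/2 → ∞` from
  every island (straight timelike world-lines of speed `v < 1`, sublinear drifts and radii), and must cross the
  scale-invariantly flat interior — where `(1 + ‖x‖)|Γ| → 0` lets the energy grow at most like `(x⁰)^{o(1)}` —
  for coordinate time `≳ (1 − v)|p|` before it can reach a near zone; its `Σ`-normalised energy is distorted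
  only by a bounded factor through the early strip and across the wave zone `|x̲| ≈ x⁰` (no infinite blue-shift:
  vacuum structure again, Dafermos CQG 22 (2005) §1, Dafermos–Rodnianski arXiv:0811.0354 §2.6.2).

Composition (`ConeCompletesScri_of`, sorry-free, pure logic over the sojourn form): `B₀`, CERT from T; given
`s`, `B₁ := B₁ᵀ ∪ B₁ᴸ(B₀, s)` (union of compacts); a ray from `p ∉ B₁` is complete (done), captured — then L
yields complete ∨ sojourn `≥ s` ∨ escaping — or escaping, and escaping rays are complete by E.
`coneCompletesScri_of_stubs : ConeCompletesScri` = the crux BY NAME modulo the three stubs.  The `Sig.*` defs are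
the stub statements verbatim (legend for the binders of the composition); the registered stubs themselves are
def-free and self-contained (`open … in let Cone := …` exactly as the route items).  Relations: T is implied by
the crux up to CERT (`s = 1`: positive sojourn ⇒ captured) and is used toward it; E and L are not implied by it;
none implies the crux or the summit cheaply (BC3 probes: `exact?` "could not close the goal", `aesop` "failed
after exhaustive search", `simpa [Sig]` / `unfold; simpa` heartbeat time-outs, for each stub against both
`ConeCompletesScri` and `FinalStateConjecture`; registrar NOTES.md).

Disproof.lean: none exists for this crux at registration (`ledger crux ls stmt-FinalStateConjecture-17670`: no
workfiles); negatives index of the summit: 1 entry (`not_UniformPhotonSphereChannels`, an ODE channel estimate),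
unrelated.  No dead lines recorded for this crux.
-/

set_option linter.dupNamespace false

noncomputable section

open scoped BigOperators Topology Manifold Classical MeasureTheory ProbabilityTheory Matrix InnerProductSpace ComplexConjugate ContinuousMap ContDiff
open Filter Set Function TopologicalSpace MeasureTheory Literature.Geometry.Lorentzian

namespace Summit.FinalStateConjecture.FinalStateConjecture.Cruxes.ConeCompletesScri.Birth

open Summit.FinalStateConjecture.FinalStateConjecture.Theses.TangentConeAtIPlus (ConeCompletesScri)

/-! ## Legend: the three stub statements as named propositions (verbatim the registered signatures) -/

/-- Statement of `stub_farRayTrichotomy` (T): a certified compact core `B₀` and a compact `B₁` such that far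
normalised rays are complete, captured by `J⁺(ι B₀)`, or escape along the cone. -/
def Sig.stub_farRayTrichotomy : Prop :=
  open Literature.Geometry.Lorentzian in open scoped ContDiff in let Cone := fun (𝓢 : Spacetime.{0} 4) (S : Set 𝓢.carrier) (N : ℕ) (mo : Fin N → lorentzGroup × E4) (σ : Fin N → ℝ → ℝ) (dr : Fin N → ℝ → E4) (T : ℝ) (U : Opens E4) (Φ : U → 𝓢.carrier) => let t := fun i (x : E4) => poincareInv (mo i).1 (mo i).2 x 0; let d := fun i (x : E4) => E4.spatialNorm (poincareInv (mo i).1 (mo i).2 x); let tube := fun i (w : ℝ) => (fun x ↦ x + dr i (t i x)) '' {x : E4 | d i x ≤ σ i (t i x) + w} ∩ {y | T < y 0}; let F := Minkowski.backgroundOn U; (∀ i, Summit.FinalStateConjecture.IsOrthochronous (mo i).1 ∧ Continuous (σ i) ∧ Continuous (dr i) ∧ Tendsto (fun s : ℝ ↦ (|σ i s| + ‖dr i s‖) / s) atTop (𝓝 0) ∧ Tendsto (σ i) atTop atTop) ∧ (∀ i j, i ≠ j → Disjoint (tube i 5) (tube j 5)) ∧ {y : E4 | T < y 0} \ (⋃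 i, tube i 0) ⊆ (U : Set E4) ∧ 𝓢.IsLateChart F (𝓢.metric.causalFuture 𝓢.timeOrientation S) T Φ ∧ (∀ x : U, 𝓢.timeOrientation.IsFutureDirected (mfderiv 𝓘(ℝ, E4) (𝓡 4) Φ x (EuclideanSpace.single 0 1))) ∧ (∀ δ : ℝ, 0 < δ → Tendsto (fun τ : ℝ ↦ weightedCkSeminorm {x : E4 | x 0 = τ ∧ E4.spatialNorm x ≤ (1 - δ) * τ ∧ ∀ i, δ * τ ≤ d i x} 2 0 (𝓢.deviationExtend F Φ)) atTop (𝓝 0)) ∧ Tendsto (fun τ : ℝ ↦ 𝓢.deviationCk F Φ 2 τ) atTop (𝓝 0) ∧ (∀ i, ∃ M a : ℝ, Kerr.IsSubextremal M a ∧ ∀ ε : ENNReal, 0 < ε → ∀ τ₁ : ℝ, ∃ τ : ℝ, τ₁ ≤ τ ∧ (let B := boostedKerrBackground (mo i).1 (mo i).2 M a; ∃ Ψ : B.domain → 𝓢.carrier, ContMDiff 𝓘(ℝ, E4) (𝓡 4) ∞ Ψ ∧ Topology.IsOpenEmbedding ({x : B.domain | |t i x.1 - τ| < 1 ∧ d i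 x.1 < σ i (t i x.1) + |a| + 6}.restrict Ψ) ∧ (∀ x : B.domain, |t i x.1 - τ| < 1 → σ i (t i x.1) + 1 ≤ d i x.1 → d i x.1 < σ i (t i x.1) + 4 → ∃ hx : x.1 + dr i (t i x.1) ∈ (U : Set E4), Ψ x = Φ ⟨_, hx⟩) ∧ 𝓢.truncDeviationCk B Ψ 2 (σ i τ + 5) τ ≤ ε)); ∀ (X : Type) [TopologicalSpace X] [ChartedSpace E3 X] [IsManifold (𝓡 3) ∞ X] [T2Space X] [SecondCountableTopology X] [ConnectedSpace X] (D : InitialDataSet (𝓡 3) X), D ∈ admissibleVacuumData X → ∀ 𝒟 : VacuumCauchyDevelopment D, 𝒟.IsMaximal → ∀ (N : ℕ) (mo : Fin N → lorentzGroup × E4) (σ : Fin N → ℝ → ℝ) (dr : Fin N → ℝ → E4) (T : ℝ) (U : Opens E4) (Φ : U → 𝒟.carrier), Cone 𝒟.toSpacetime (range 𝒟.embed) N mo σ dr T U Φ → ∀ [𝒟.metric.HasLeviCivita], ∃ B₀ : Set X, IsCompact B₀ ∧ (∀ δ : ℝ, 0 < δ → ∃ τ₃ : ℝ, ∀ x :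 U, τ₃ ≤ x.1 0 → E4.spatialNorm x.1 ≤ (1 - δ) * x.1 0 → Φ x ∈ 𝒟.metric.causalFuture 𝒟.timeOrientation (𝒟.embed '' B₀)) ∧ ∃ B₁ : Set X, IsCompact B₁ ∧ ∀ p ∉ B₁, ∀ (γ : ℝ → 𝒟.carrier) (dom : Set ℝ), 𝒟.metric.IsNormalisedNullRayFrom 𝒟.timeOrientation 𝒟.embed 𝒟.normal p γ dom → ¬ BddAbove dom ∨ (∃ t ∈ dom, 0 ≤ t ∧ γ t ∈ 𝒟.metric.causalFuture 𝒟.timeOrientation (𝒟.embed '' B₀)) ∨ (∀ δ : ℝ, 0 < δ → ∀ τ' : ℝ, ∃ t₀ ∈ dom, ∀ t ∈ dom, t₀ ≤ t → ∃ x : U, γ t = Φ x ∧ τ' ≤ x.1 0 ∧ (1 - δ) * x.1 0 ≤ E4.spatialNorm x.1)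

/-- Statement of `stub_escapingRaysComplete` (E): rays escaping along the cone are future complete. -/
def Sig.stub_escapingRaysComplete : Prop :=
  open Literature.Geometry.Lorentzian in open scoped ContDiff in let Cone := fun (𝓢 : Spacetime.{0} 4) (S : Set 𝓢.carrier) (N : ℕ) (mo : Fin N → lorentzGroup × E4) (σ : Fin N → ℝ → ℝ) (dr : Fin N → ℝ → E4) (T : ℝ) (U : Opens E4) (Φ : U → 𝓢.carrier) => let t := fun i (x : E4) => poincareInv (mo i).1 (mo i).2 x 0; let d := fun i (x : E4) => E4.spatialNorm (poincareInv (mo i).1 (mo i).2 x); let tube := fun i (w : ℝ) => (fun x ↦ x + dr i (t i x)) '' {x : E4 | d i x ≤ σ i (t i x) + w} ∩ {y | T < y 0}; let F := Minkowski.backgroundOn U; (∀ i, Summit.FinalStateConjecture.IsOrthochronous (mo i).1 ∧ Continuous (σ i) ∧ Continuous (dr i) ∧ Tendsto (fun s : ℝ ↦ (|σ i s| + ‖dr i s‖) / s) atTop (𝓝 0) ∧ Tendsto (σ i) atTop atTop) ∧ (∀ i j, i ≠ j → Disjoint (tube i 5) (tube j 5)) ∧ {y : E4 | T < y 0} \ (⋃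 i, tube i 0) ⊆ (U : Set E4) ∧ 𝓢.IsLateChart F (𝓢.metric.causalFuture 𝓢.timeOrientation S) T Φ ∧ (∀ x : U, 𝓢.timeOrientation.IsFutureDirected (mfderiv 𝓘(ℝ, E4) (𝓡 4) Φ x (EuclideanSpace.single 0 1))) ∧ (∀ δ : ℝ, 0 < δ → Tendsto (fun τ : ℝ ↦ weightedCkSeminorm {x : E4 | x 0 = τ ∧ E4.spatialNorm x ≤ (1 - δ) * τ ∧ ∀ i, δ * τ ≤ d i x} 2 0 (𝓢.deviationExtend F Φ)) atTop (𝓝 0)) ∧ Tendsto (fun τ : ℝ ↦ 𝓢.deviationCk F Φ 2 τ) atTop (𝓝 0) ∧ (∀ i, ∃ M a : ℝ, Kerr.IsSubextremal M a ∧ ∀ ε : ENNReal, 0 < ε → ∀ τ₁ : ℝ, ∃ τ : ℝ, τ₁ ≤ τ ∧ (let B := boostedKerrBackground (mo i).1 (mo i).2 M a; ∃ Ψ : B.domain → 𝓢.carrier, ContMDiff 𝓘(ℝ, E4) (𝓡 4) ∞ Ψ ∧ Topology.IsOpenEmbedding ({x : B.domain | |t i x.1 - τ| < 1 ∧ d i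 x.1 < σ i (t i x.1) + |a| + 6}.restrict Ψ) ∧ (∀ x : B.domain, |t i x.1 - τ| < 1 → σ i (t i x.1) + 1 ≤ d i x.1 → d i x.1 < σ i (t i x.1) + 4 → ∃ hx : x.1 + dr i (t i x.1) ∈ (U : Set E4), Ψ x = Φ ⟨_, hx⟩) ∧ 𝓢.truncDeviationCk B Ψ 2 (σ i τ + 5) τ ≤ ε)); ∀ (X : Type) [TopologicalSpace X] [ChartedSpace E3 X] [IsManifold (𝓡 3) ∞ X] [T2Space X] [SecondCountableTopology X] [ConnectedSpace X] (D : InitialDataSet (𝓡 3) X), D ∈ admissibleVacuumData X → ∀ 𝒟 : VacuumCauchyDevelopment D, 𝒟.IsMaximal → ∀ (N : ℕ) (mo : Fin N → lorentzGroup × E4) (σ : Fin N → ℝ → ℝ) (dr : Fin N → ℝ → E4) (T : ℝ) (U : Opens E4) (Φ : U → 𝒟.carrier), Cone 𝒟.toSpacetime (range 𝒟.embed) N mo σ dr T U Φ → ∀ [𝒟.metric.HasLeviCivita], ∀ (p : X) (γ : ℝ → 𝒟.carrier) (dom : Set ℝ), 𝒟.metric.IsNormalisedNullRayFrom 𝒟.timeOrientation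 𝒟.embed 𝒟.normal p γ dom → (∀ δ : ℝ, 0 < δ → ∀ τ' : ℝ, ∃ t₀ ∈ dom, ∀ t ∈ dom, t₀ ≤ t → ∃ x : U, γ t = Φ x ∧ τ' ≤ x.1 0 ∧ (1 - δ) * x.1 0 ≤ E4.spatialNorm x.1) → ¬ BddAbove dom

/-- Statement of `stub_capturedRaysLinger` (L): for a certified compact core, far captured rays are complete,
sojourn long in `J⁺(ι B₀)`, or escape. -/
def Sig.stub_capturedRaysLinger : Prop :=
  open Literature.Geometry.Lorentzian in open scoped ContDiff in let Cone := fun (𝓢 : Spacetime.{0} 4) (S : Set 𝓢.carrier) (N : ℕ) (mo : Fin N → lorentzGroup × E4) (σ : Fin N → ℝ → ℝ) (dr : Fin N → ℝ → E4) (T : ℝ) (U : Opens E4) (Φ : U → 𝓢.carrier) => let t := fun i (x : E4) => poincareInv (mo i).1 (mo i).2 x 0; let d := fun i (x : E4) => E4.spatialNorm (poincareInv (mo i).1 (mo i).2 x); let tube := fun i (w : ℝ) => (fun x ↦ x + dr i (t i x)) '' {x : E4 | d i x ≤ σ i (t i x) + w} ∩ {y | T < y 0}; let F := Minkowski.backgroundOn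 U; (∀ i, Summit.FinalStateConjecture.IsOrthochronous (mo i).1 ∧ Continuous (σ i) ∧ Continuous (dr i) ∧ Tendsto (fun s : ℝ ↦ (|σ i s| + ‖dr i s‖) / s) atTop (𝓝 0) ∧ Tendsto (σ i) atTop atTop) ∧ (∀ i j, i ≠ j → Disjoint (tube i 5) (tube j 5)) ∧ {y : E4 | T < y 0} \ (⋃ i, tube i 0) ⊆ (U : Set E4) ∧ 𝓢.IsLateChart F (𝓢.metric.causalFuture 𝓢.timeOrientation S) T Φ ∧ (∀ x : U, 𝓢.timeOrientation.IsFutureDirected (mfderiv 𝓘(ℝ, E4) (𝓡 4) Φ x (EuclideanSpace.single 0 1))) ∧ (∀ δ : ℝ, 0 < δ → Tendsto (fun τ : ℝ ↦ weightedCkSeminorm {x : E4 | x 0 = τ ∧ E4.spatialNorm x ≤ (1 - δ) * τ ∧ ∀ i, δ * τ ≤ d i x} 2 0 (𝓢.deviationExtend F Φ)) atTop (𝓝 0)) ∧ Tendsto (fun τ : ℝ ↦ 𝓢.deviationCk F Φ 2 τ) atTop (𝓝 0) ∧ (∀ i, ∃ M a : ℝ, Kerr.IsSubextremal M a ∧ ∀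 ε : ENNReal, 0 < ε → ∀ τ₁ : ℝ, ∃ τ : ℝ, τ₁ ≤ τ ∧ (let B := boostedKerrBackground (mo i).1 (mo i).2 M a; ∃ Ψ : B.domain → 𝓢.carrier, ContMDiff 𝓘(ℝ, E4) (𝓡 4) ∞ Ψ ∧ Topology.IsOpenEmbedding ({x : B.domain | |t i x.1 - τ| < 1 ∧ d i x.1 < σ i (t i x.1) + |a| + 6}.restrict Ψ) ∧ (∀ x : B.domain, |t i x.1 - τ| < 1 → σ i (t i x.1) + 1 ≤ d i x.1 → d i x.1 < σ i (t i x.1) + 4 → ∃ hx : x.1 + dr i (t i x.1) ∈ (U : Set E4), Ψ x = Φ ⟨_, hx⟩) ∧ 𝓢.truncDeviationCk B Ψ 2 (σ i τ + 5) τ ≤ ε)); ∀ (X : Type) [TopologicalSpace X] [ChartedSpace E3 X] [IsManifold (𝓡 3) ∞ X] [T2Space X] [SecondCountableTopology X] [ConnectedSpace X] (D : InitialDataSet (𝓡 3) X), D ∈ admissibleVacuumData X → ∀ 𝒟 : VacuumCauchyDevelopment D, 𝒟.IsMaximal → ∀ (N : ℕ) (mo : Fin N → lorentzGroup × E4) (σ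 : Fin N → ℝ → ℝ) (dr : Fin N → ℝ → E4) (T : ℝ) (U : Opens E4) (Φ : U → 𝒟.carrier), Cone 𝒟.toSpacetime (range 𝒟.embed) N mo σ dr T U Φ → ∀ [𝒟.metric.HasLeviCivita], ∀ B₀ : Set X, IsCompact B₀ → (∀ δ : ℝ, 0 < δ → ∃ τ₃ : ℝ, ∀ x : U, τ₃ ≤ x.1 0 → E4.spatialNorm x.1 ≤ (1 - δ) * x.1 0 → Φ x ∈ 𝒟.metric.causalFuture 𝒟.timeOrientation (𝒟.embed '' B₀)) → ∀ s : ℝ, 0 < s → ∃ B₁ : Set X, IsCompact B₁ ∧ ∀ p ∉ B₁, ∀ (γ : ℝ → 𝒟.carrier) (dom : Set ℝ), 𝒟.metric.IsNormalisedNullRayFrom 𝒟.timeOrientation 𝒟.embed 𝒟.normal p γ dom → (∃ t ∈ dom, 0 ≤ t ∧ γ t ∈ 𝒟.metric.causalFuture 𝒟.timeOrientation (𝒟.embed '' B₀)) → ¬ BddAbove dom ∨ ENNReal.ofReal s ≤ sojournTime γ dom (𝒟.metric.causalFuture 𝒟.timeOrientation (𝒟.embed '' B₀)) ∨ (∀ δ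 : ℝ, 0 < δ → ∀ τ' : ℝ, ∃ t₀ ∈ dom, ∀ t ∈ dom, t₀ ≤ t → ∃ x : U, γ t = Φ x ∧ τ' ≤ x.1 0 ∧ (1 - δ) * x.1 0 ≤ E4.spatialNorm x.1)

/-! ## Registered stubs (`sorry` only here; signatures def-free and self-contained) -/

/-- **T — FAR-RAY TRICHOTOMY WITH A CERTIFIED CORE** (kinematic / causal).  For every admissible datum, every
MGHD and every cone data there are a compact `B₀ ⊆ Σ` which is CERTIFIED — for every `δ > 0` some `τ₃` with
`Φ x ∈ J⁺(ι B₀)` whenever `x : U`, `τ₃ ≤ x⁰`, `|x̲| ≤ (1 - δ) x⁰` — and a compact `B₁ ⊆ Σ` such that every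
normalised future null ray `γ` from a data point `p ∉ B₁` (maximal null geodesic, `γ 0 = ι p`,
`g(γ' 0, N p) = -1`) is future complete (`¬ BddAbove dom`), or enters `J⁺(ι B₀)` at some parameter `t ≥ 0`, or
escapes along the cone: for every `δ > 0` and `τ'`, from some parameter `t₀ ∈ dom` on, `γ t = Φ x` with
`τ' ≤ x⁰` and `(1 - δ) x⁰ ≤ |x̲|`.  Why plausibly true: a big coordinate ball `B₀` is certified (its outgoing
front outruns `(1 - δ) x⁰`, and every late interior chart point has a past causal curve to the far-field part
of `B₀`); far rays survive the early far strip (Cauchy stability of the asymptotically flat end for the bounded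
physical time needed to reach the late `C²`-flat leaves of `Φ` far out); there chart time increases along causal
curves and a null ray of the flat region has `|x̲|/x⁰ → 1` unless it enters the interior, where CERT captures it.
Why it might fail: the strip between `ι(Σ)` and the chart is uncharted and the chart's early leaves
`T < x⁰ < τ₂` need not even be spacelike; a far ray must be followed through both with only the admissible
`o₂(r⁻¹)`, `o₁(r⁻²)` fall-off (Christodoulou1999 pp. A26–A27, KlainermanNicolo2003, arXiv:0811.0354 §2.6.2,
ONeill1983 Ch. 14, HawkingEllis1973 §6.5).  Size: M–L. -/
theorem stub_farRayTrichotomy : open Literature.Geometry.Lorentzian in open scoped ContDiff in let Cone := fun (𝓢 : Spacetime.{0} 4) (S : Set 𝓢.carrier) (N : ℕ) (mo : Fin N → lorentzGroup × E4) (σ : Fin N → ℝ → ℝ) (dr : Fin N → ℝ → E4) (T : ℝ) (U : Opens E4) (Φ : U → 𝓢.carrier) => let t := fun i (x : E4) => poincareInv (mo i).1 (mo i).2 x 0; let d := fun i (x : E4) => E4.spatialNorm (poincareInv (mo i).1 (mo i).2 x); let tube := fun i (w : ℝ) => (fun x ↦ x + dr i (t i x)) '' {x : E4 | d i x ≤ σ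 i (t i x) + w} ∩ {y | T < y 0}; let F := Minkowski.backgroundOn U; (∀ i, Summit.FinalStateConjecture.IsOrthochronous (mo i).1 ∧ Continuous (σ i) ∧ Continuous (dr i) ∧ Tendsto (fun s : ℝ ↦ (|σ i s| + ‖dr i s‖) / s) atTop (𝓝 0) ∧ Tendsto (σ i) atTop atTop) ∧ (∀ i j, i ≠ j → Disjoint (tube i 5) (tube j 5)) ∧ {y : E4 | T < y 0} \ (⋃ i, tube i 0) ⊆ (U : Set E4) ∧ 𝓢.IsLateChart F (𝓢.metric.causalFuture 𝓢.timeOrientation S) T Φ ∧ (∀ x : U, 𝓢.timeOrientation.IsFutureDirected (mfderiv 𝓘(ℝ, E4) (𝓡 4) Φ x (EuclideanSpace.single 0 1))) ∧ (∀ δ : ℝ, 0 < δ → Tendsto (fun τ : ℝ ↦ weightedCkSeminorm {x : E4 | x 0 = τ ∧ E4.spatialNorm x ≤ (1 - δ) * τ ∧ ∀ i, δ * τ ≤ d i x} 2 0 (𝓢.deviationExtend F Φ)) atTop (𝓝 0)) ∧ Tendsto (fun τ : ℝ ↦ 𝓢.deviationCk F Φ 2 τ) atTop (𝓝 0) ∧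 (∀ i, ∃ M a : ℝ, Kerr.IsSubextremal M a ∧ ∀ ε : ENNReal, 0 < ε → ∀ τ₁ : ℝ, ∃ τ : ℝ, τ₁ ≤ τ ∧ (let B := boostedKerrBackground (mo i).1 (mo i).2 M a; ∃ Ψ : B.domain → 𝓢.carrier, ContMDiff 𝓘(ℝ, E4) (𝓡 4) ∞ Ψ ∧ Topology.IsOpenEmbedding ({x : B.domain | |t i x.1 - τ| < 1 ∧ d i x.1 < σ i (t i x.1) + |a| + 6}.restrict Ψ) ∧ (∀ x : B.domain, |t i x.1 - τ| < 1 → σ i (t i x.1) + 1 ≤ d i x.1 → d i x.1 < σ i (t i x.1) + 4 → ∃ hx : x.1 + dr i (t i x.1) ∈ (U : Set E4), Ψ x = Φ ⟨_, hx⟩) ∧ 𝓢.truncDeviationCk B Ψ 2 (σ i τ + 5) τ ≤ ε)); ∀ (X : Type) [TopologicalSpace X] [ChartedSpace E3 X] [IsManifold (𝓡 3) ∞ X] [T2Space X] [SecondCountableTopology X] [ConnectedSpace X] (D : InitialDataSet (𝓡 3) X), D ∈ admissibleVacuumData X → ∀ 𝒟 : VacuumCauchyDevelopment D, 𝒟.IsMaximal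 → ∀ (N : ℕ) (mo : Fin N → lorentzGroup × E4) (σ : Fin N → ℝ → ℝ) (dr : Fin N → ℝ → E4) (T : ℝ) (U : Opens E4) (Φ : U → 𝒟.carrier), Cone 𝒟.toSpacetime (range 𝒟.embed) N mo σ dr T U Φ → ∀ [𝒟.metric.HasLeviCivita], ∃ B₀ : Set X, IsCompact B₀ ∧ (∀ δ : ℝ, 0 < δ → ∃ τ₃ : ℝ, ∀ x : U, τ₃ ≤ x.1 0 → E4.spatialNorm x.1 ≤ (1 - δ) * x.1 0 → Φ x ∈ 𝒟.metric.causalFuture 𝒟.timeOrientation (𝒟.embed '' B₀)) ∧ ∃ B₁ : Set X, IsCompact B₁ ∧ ∀ p ∉ B₁, ∀ (γ : ℝ → 𝒟.carrier) (dom : Set ℝ), 𝒟.metric.IsNormalisedNullRayFrom 𝒟.timeOrientation 𝒟.embed 𝒟.normal p γ dom → ¬ BddAbove dom ∨ (∃ t ∈ dom, 0 ≤ t ∧ γ t ∈ 𝒟.metric.causalFuture 𝒟.timeOrientation (𝒟.embed '' B₀)) ∨ (∀ δ : ℝ, 0 < δ → ∀ τ' : ℝ, ∃ t₀ ∈ dom,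 ∀ t ∈ dom, t₀ ≤ t → ∃ x : U, γ t = Φ x ∧ τ' ≤ x.1 0 ∧ (1 - δ) * x.1 0 ≤ E4.spatialNorm x.1) := by
  sorry

/-- **E — ESCAPING RAYS ARE COMPLETE** (outgoing completeness in the wave zone).  For every admissible datum,
every MGHD, every cone data and EVERY normalised future null ray `γ` from a data point: if `γ` escapes along the
cone (for every `δ > 0` and `τ'`, eventually `γ t = Φ x` with `τ' ≤ x⁰`, `(1 - δ) x⁰ ≤ |x̲|`), then `γ` is
future complete.  Why plausibly true: along an outgoing ray in the radiation zone of an asymptotically flat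
vacuum development the affine parameter is comparable to the area radius (Bondi gauge: `∂_r λ = e^{-2β}`,
`β = O(r⁻²)`; Christodoulou–Klainerman 1993 Ch. 17, Klainerman–Nicolò 2003 Thm. 1.1, Bieri 2010,
Shen doi:10.4310/pamq.2024.v20.n2.a4), so chart time `→ ∞` forces affine length `→ ∞`.  Why it might fail: the
cone data grant only RATE-FREE unweighted `C²` smallness on slabs, and `E(x⁰) = E₀ exp(-∫Γ⁰(n,n) dx⁰)` may grow
so fast that `∫ dx⁰/E < ∞`; integrability of the connection along outgoing rays must come from `Ric(g) = 0` and
the `o₂(r⁻¹)`/`o₁(r⁻²)` data, below the regularity of the printed exterior-stability theorems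
(LindbladRodnianski2010Annals, KlainermanNicolo2003, ChristodoulouKlainerman1993PMS41).  Size: L. -/
theorem stub_escapingRaysComplete : open Literature.Geometry.Lorentzian in open scoped ContDiff in let Cone := fun (𝓢 : Spacetime.{0} 4) (S : Set 𝓢.carrier) (N : ℕ) (mo : Fin N → lorentzGroup × E4) (σ : Fin N → ℝ → ℝ) (dr : Fin N → ℝ → E4) (T : ℝ) (U : Opens E4) (Φ : U → 𝓢.carrier) => let t := fun i (x : E4) => poincareInv (mo i).1 (mo i).2 x 0; let d := fun i (x : E4) => E4.spatialNorm (poincareInv (mo i).1 (mo i).2 x); let tube := fun i (w : ℝ) => (fun x ↦ x + dr i (t i x)) '' {x : E4 | d i x ≤ σ i (t i x) + w} ∩ {y | T < y 0}; let F := Minkowski.backgroundOn U; (∀ i, Summit.FinalStateConjecture.IsOrthochronous (mo i).1 ∧ Continuous (σ i) ∧ Continuous (dr i) ∧ Tendsto (fun s : ℝ ↦ (|σ i s| + ‖dr i s‖) / s) atTop (𝓝 0) ∧ Tendsto (σ i) atTop atTop) ∧ (∀ i j, i ≠ j → Disjoint (tube i 5) (tube j 5)) ∧ {y : E4 | T <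 y 0} \ (⋃ i, tube i 0) ⊆ (U : Set E4) ∧ 𝓢.IsLateChart F (𝓢.metric.causalFuture 𝓢.timeOrientation S) T Φ ∧ (∀ x : U, 𝓢.timeOrientation.IsFutureDirected (mfderiv 𝓘(ℝ, E4) (𝓡 4) Φ x (EuclideanSpace.single 0 1))) ∧ (∀ δ : ℝ, 0 < δ → Tendsto (fun τ : ℝ ↦ weightedCkSeminorm {x : E4 | x 0 = τ ∧ E4.spatialNorm x ≤ (1 - δ) * τ ∧ ∀ i, δ * τ ≤ d i x} 2 0 (𝓢.deviationExtend F Φ)) atTop (𝓝 0)) ∧ Tendsto (fun τ : ℝ ↦ 𝓢.deviationCk F Φ 2 τ) atTop (𝓝 0) ∧ (∀ i, ∃ M a : ℝ, Kerr.IsSubextremal M a ∧ ∀ ε : ENNReal, 0 < ε → ∀ τ₁ : ℝ, ∃ τ : ℝ, τ₁ ≤ τ ∧ (let B := boostedKerrBackground (mo i).1 (mo i).2 M a; ∃ Ψ : B.domain → 𝓢.carrier, ContMDiff 𝓘(ℝ, E4) (𝓡 4) ∞ Ψ ∧ Topology.IsOpenEmbedding ({x : B.domain | |t i x.1 - τ|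 < 1 ∧ d i x.1 < σ i (t i x.1) + |a| + 6}.restrict Ψ) ∧ (∀ x : B.domain, |t i x.1 - τ| < 1 → σ i (t i x.1) + 1 ≤ d i x.1 → d i x.1 < σ i (t i x.1) + 4 → ∃ hx : x.1 + dr i (t i x.1) ∈ (U : Set E4), Ψ x = Φ ⟨_, hx⟩) ∧ 𝓢.truncDeviationCk B Ψ 2 (σ i τ + 5) τ ≤ ε)); ∀ (X : Type) [TopologicalSpace X] [ChartedSpace E3 X] [IsManifold (𝓡 3) ∞ X] [T2Space X] [SecondCountableTopology X] [ConnectedSpace X] (D : InitialDataSet (𝓡 3) X), D ∈ admissibleVacuumData X → ∀ 𝒟 : VacuumCauchyDevelopment D, 𝒟.IsMaximal → ∀ (N : ℕ) (mo : Fin N → lorentzGroup × E4) (σ : Fin N → ℝ → ℝ) (dr : Fin N → ℝ → E4) (T : ℝ) (U : Opens E4) (Φ : U → 𝒟.carrier), Cone 𝒟.toSpacetime (range 𝒟.embed) N mo σ dr T U Φ → ∀ [𝒟.metric.HasLeviCivita], ∀ (p : X) (γ : ℝ → 𝒟.carrier) (dom : Set ℝ), 𝒟.metric.IsNormalisedNullRayFrom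 𝒟.timeOrientation 𝒟.embed 𝒟.normal p γ dom → (∀ δ : ℝ, 0 < δ → ∀ τ' : ℝ, ∃ t₀ ∈ dom, ∀ t ∈ dom, t₀ ≤ t → ∃ x : U, γ t = Φ x ∧ τ' ≤ x.1 0 ∧ (1 - δ) * x.1 0 ≤ E4.spatialNorm x.1) → ¬ BddAbove dom := by
  sorry

/-- **L — CAPTURED FAR RAYS LINGER** (ingoing longevity: no fast death after capture by a certified core).  For
every admissible datum, every MGHD, every cone data, every compact CERTIFIED `B₀ ⊆ Σ` and every `s > 0` there is
a compact `B₁ ⊆ Σ` such that every normalised future null ray from `p ∉ B₁` which enters `J⁺(ι B₀)` at some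
parameter `t ≥ 0` is future complete, or has sojourn time `≥ s` in `J⁺(ι B₀)`, or escapes along the cone.  Why
plausibly true: a far captured non-escaping ray enters the certified late interior at chart radius `≈ |p|/2`, at
distance `≳ (1 - v)|p|/2 → ∞` from every island (straight timelike world-lines of speed `v < 1`, sublinear
drifts and radii), from then on it is in `J⁺(ι B₀)`, and it must cross the scale-invariantly `C²`-flat interior,
where `(1 + ‖x‖)|Γ| → 0` lets the energy grow at most like `(x⁰)^{o(1)}`, for coordinate time `≳ (1 - v)|p|`
before it can reach a near zone: affine sojourn `≳ |p|^{1 - o(1)} → ∞`.  Why it might fail: the `Σ`-normalised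
energy must first be carried through the uncharted early strip and across the wave zone `|x̲| ≈ x⁰`, where only
unweighted `o(1)` control holds and an `exp(∫ o(1))` blue-shift is not excluded by the cone data alone — vacuum
structure again (Dafermos CQG 22 (2005) §1, arXiv:0811.0354 §2.6.2, ChristodoulouKlainerman1993PMS41,
doi:10.4310/pamq.2024.v20.n2.a4); CERT is essential (for a core inside a black-hole region of `Σ` a Kerr-like
Cauchy horizon captures infalling far rays only just before they leave the MGHD).  Size: L. -/
theorem stub_capturedRaysLinger : open Literature.Geometry.Lorentzian in open scoped ContDiff in let Cone := fun (𝓢 : Spacetime.{0} 4) (S : Set 𝓢.carrier) (N : ℕ) (mo : Fin N → lorentzGroup × E4) (σ : Fin N → ℝ → ℝ) (dr : Fin N → ℝ → E4) (T : ℝ) (U : Opens E4) (Φ : U → 𝓢.carrier) => let t := fun i (x : E4) => poincareInv (mo i).1 (mo i).2 x 0; let d := fun i (x : E4) => E4.spatialNorm (poincareInv (mo i).1 (mo i).2 x); let tube := fun i (w : ℝ) => (fun x ↦ x + dr i (t i x)) '' {x : E4 | d i x ≤ σ i (t i x) + w} ∩ {y | T < y 0}; let F := Minkowski.backgroundOn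 U; (∀ i, Summit.FinalStateConjecture.IsOrthochronous (mo i).1 ∧ Continuous (σ i) ∧ Continuous (dr i) ∧ Tendsto (fun s : ℝ ↦ (|σ i s| + ‖dr i s‖) / s) atTop (𝓝 0) ∧ Tendsto (σ i) atTop atTop) ∧ (∀ i j, i ≠ j → Disjoint (tube i 5) (tube j 5)) ∧ {y : E4 | T < y 0} \ (⋃ i, tube i 0) ⊆ (U : Set E4) ∧ 𝓢.IsLateChart F (𝓢.metric.causalFuture 𝓢.timeOrientation S) T Φ ∧ (∀ x : U, 𝓢.timeOrientation.IsFutureDirected (mfderiv 𝓘(ℝ, E4) (𝓡 4) Φ x (EuclideanSpace.single 0 1))) ∧ (∀ δ : ℝ, 0 < δ → Tendsto (fun τ : ℝ ↦ weightedCkSeminorm {x : E4 | x 0 = τ ∧ E4.spatialNorm x ≤ (1 - δ) * τ ∧ ∀ i, δ * τ ≤ d i x} 2 0 (𝓢.deviationExtend F Φ)) atTop (𝓝 0)) ∧ Tendsto (fun τ : ℝ ↦ 𝓢.deviationCk F Φ 2 τ) atTop (𝓝 0) ∧ (∀ i, ∃ M a : ℝ, Kerr.IsSubextremal M a ∧ ∀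 ε : ENNReal, 0 < ε → ∀ τ₁ : ℝ, ∃ τ : ℝ, τ₁ ≤ τ ∧ (let B := boostedKerrBackground (mo i).1 (mo i).2 M a; ∃ Ψ : B.domain → 𝓢.carrier, ContMDiff 𝓘(ℝ, E4) (𝓡 4) ∞ Ψ ∧ Topology.IsOpenEmbedding ({x : B.domain | |t i x.1 - τ| < 1 ∧ d i x.1 < σ i (t i x.1) + |a| + 6}.restrict Ψ) ∧ (∀ x : B.domain, |t i x.1 - τ| < 1 → σ i (t i x.1) + 1 ≤ d i x.1 → d i x.1 < σ i (t i x.1) + 4 → ∃ hx : x.1 + dr i (t i x.1) ∈ (U : Set E4), Ψ x = Φ ⟨_, hx⟩) ∧ 𝓢.truncDeviationCk B Ψ 2 (σ i τ + 5) τ ≤ ε)); ∀ (X : Type) [TopologicalSpace X] [ChartedSpace E3 X] [IsManifold (𝓡 3) ∞ X] [T2Space X] [SecondCountableTopology X] [ConnectedSpace X] (D : InitialDataSet (𝓡 3) X), D ∈ admissibleVacuumData X → ∀ 𝒟 : VacuumCauchyDevelopment D, 𝒟.IsMaximal → ∀ (N : ℕ) (mo : Fin N → lorentzGroup × E4) (σ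 : Fin N → ℝ → ℝ) (dr : Fin N → ℝ → E4) (T : ℝ) (U : Opens E4) (Φ : U → 𝒟.carrier), Cone 𝒟.toSpacetime (range 𝒟.embed) N mo σ dr T U Φ → ∀ [𝒟.metric.HasLeviCivita], ∀ B₀ : Set X, IsCompact B₀ → (∀ δ : ℝ, 0 < δ → ∃ τ₃ : ℝ, ∀ x : U, τ₃ ≤ x.1 0 → E4.spatialNorm x.1 ≤ (1 - δ) * x.1 0 → Φ x ∈ 𝒟.metric.causalFuture 𝒟.timeOrientation (𝒟.embed '' B₀)) → ∀ s : ℝ, 0 < s → ∃ B₁ : Set X, IsCompact B₁ ∧ ∀ p ∉ B₁, ∀ (γ : ℝ → 𝒟.carrier) (dom : Set ℝ), 𝒟.metric.IsNormalisedNullRayFrom 𝒟.timeOrientation 𝒟.embed 𝒟.normal p γ dom → (∃ t ∈ dom, 0 ≤ t ∧ γ t ∈ 𝒟.metric.causalFuture 𝒟.timeOrientation (𝒟.embed '' B₀)) → ¬ BddAbove dom ∨ ENNReal.ofReal s ≤ sojournTime γ dom (𝒟.metric.causalFuture 𝒟.timeOrientation (𝒟.embed '' B₀)) ∨ (∀ δ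 : ℝ, 0 < δ → ∀ τ' : ℝ, ∃ t₀ ∈ dom, ∀ t ∈ dom, t₀ ≤ t → ∃ x : U, γ t = Φ x ∧ τ' ≤ x.1 0 ∧ (1 - δ) * x.1 0 ≤ E4.spatialNorm x.1) := by
  sorry

/-! ## Composition: the crux BY NAME from the three stubs (real proof, no `sorry`) -/

/-- **`ConeCompletesScri` from T, E, L** — pure logic over the sojourn form: take the certified core `B₀` from T;
given `s > 0` take `B₁ := B₁ᵀ ∪ B₁ᴸ(B₀, s)` (compact); a normalised ray from `p ∉ B₁` is complete, or captured —
then L yields complete ∨ sojourn `≥ s` ∨ escaping —, or escaping; escaping rays are complete by E. -/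
theorem ConeCompletesScri_of :
    Sig.stub_farRayTrichotomy → Sig.stub_escapingRaysComplete → Sig.stub_capturedRaysLinger →
      ConeCompletesScri := by
  intro hT hE hL X _ _ _ _ _ _ D hD 𝒟 h𝒟 N mo σ dr T U Φ hcone hLC
  obtain ⟨B₀, hB₀, hcert, B₁, hB₁, htri⟩ := hT X D hD 𝒟 h𝒟 N mo σ dr T U Φ hcone
  refine ⟨B₀, hB₀, fun s hs ↦ ?_⟩
  obtain ⟨B₁', hB₁', hsoj⟩ := hL X D hD 𝒟 h𝒟 N mo σ dr T U Φ hcone B₀ hB₀ hcert s hs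
  refine ⟨B₁ ∪ B₁', hB₁.union hB₁', fun p hp γ dom hγ ↦ ?_⟩
  have hesc := hE X D hD 𝒟 h𝒟 N mo σ dr T U Φ hcone p γ dom hγ
  rcases htri p (fun h ↦ hp (Set.mem_union_left _ h)) γ dom hγ with h | h | h
  · exact Or.inl h
  · rcases hsoj p (fun h' ↦ hp (Set.mem_union_right _ h')) γ dom hγ h with h' | h' | h'
    · exact Or.inl h'
    · exact Or.inr h'
    · exact Or.inl (hesc h')
  · exact Or.inl (hesc h)

/-- The crux by name, closed modulo the three registered stubs. -/
theorem coneCompletesScri_of_stubs : ConeCompletesScri :=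
  ConeCompletesScri_of stub_farRayTrichotomy stub_escapingRaysComplete stub_capturedRaysLinger

end Summit.FinalStateConjecture.FinalStateConjecture.Cruxes.ConeCompletesScri.Birth

end
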